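import Summits.HodgeConjecture.HodgeConjecture.Theorems.F0P3LettersTraceFactorisation     -- ★ p823853 (ED. 1, this seat): `IsProductHaar` (PH) and the UNGUARDED TF text (superseded by R-28 ∕ RULING (V44)); cone: ★ K0, ★ «RC», ★ D8-1, ★ (C-glob)
import HarnessLib

/-!
# Crux `H413` — T5 ED. 4, K8 §3, **TF ED. 2 «TraceFactorisation» WITH THE LEVEL GUARD `∃ S₀, ∀ S ⊇ S₀`** (REF1 (g6) R-28; F0P3-plan (g5) RULING (V44) «THE LEVEL PASS»,
# variant (α″): one finite exceptional set per frame, existentially, at the LAWS level)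

F0∕P3 «U3-mult», cell `hodgecm-mathlib`, crux H413 (`stmt-HodgeConjecture-24833`); pen F0P3-p02 (g7).  DEF lane (`--kind definition --supports stmt-HodgeConjecture-24833
--as helper`): ONE `def … : Prop` WITH BODY (`TraceFactorisation`, in the NEW namespace `…F0P3LettersTraceFactorisationS0` — ED. 1's unguarded ★ p823853 text keeps its
name in its own namespace and is no longer consumed), its `Iff.rfl` unfolding, and the GLUE to the kit of record; PH `IsProductHaar` is ★ ED. 1 BY NAME.  No instance, no
notation, no `sorry`.

WHY ED. 2 (R-28, accepted).  `K_v := cmLocalIntegralLevel L 3 H v` (the stabiliser of `⊕_w 𝒪_w³`) is hyperspecial ∕ a Gelfand pair only for all but FINITELY many `v`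
(★ `HyperspecialGelfandPair_holds`, ★ `eventually_isHyperspecialAt`); at a bad place an irreducible `π′_v` may have `dim π′_v^{K_v} ≥ 2` (REF1's split-place Iwahori witness),
so it is «not spherical» in the tree's sense (`IsSpherical` = the fixed space is a LINE) while `π′_v(𝟙_{K_v}) ≠ 0`: the `= 0` branch of the UNGUARDED class conjunct of law
`Factorisation` (V6∕V7-B :65–:68 = ED. 1's TF) is print-false at such `S ∌ v`.  Print itself works at `S ⊇ S₀`, `S₀` ∋ every place where the data are not unramified
[Rogawski1990 §14.6 p. 236 ll. 9–12 («`S′ ⊇ S ∪ S₀`»), §14.5 p. 232, §1.5 p. 9 (`ℋ_v` for hyperspecial `K_v` only); FlathCorvallis1979 Thm. 3 (`K_v` hyperspecial a.e.);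
CartierCorvallis1979 §IV.1 (`K` special)].  RULING (V44): the S-indexed letter laws of T5 v8 read `∀ S, S₀ ⊆ S → …` under ONE `∃ S₀ : Finset (Places L)` per frame (no new kit
socket; `kitOfRecord` ★ K0 byte-unchanged), each letter naming its own exceptional set and K9β taking unions (`‹Law›.mono`).

* §1 **`TraceFactorisation L H ι T hT μ ν νinf μv : Prop := IsProductHaar L H ν νinf μv → ∃ S₀ : Finset (Places L), ∀ S, S₀ ⊆ S → ∀ c fS fT, ‹the two conjuncts of ED. 1›`**
  — print-true (take `S₀ ⊇` the non-hyperspecial ∕ non-Gelfand places of `(L, H)`): for `S ⊇ S₀`, every `v ∉ S` has `dim π′_v^{K_v} ∈ {0, 1}`, so «`v ∈ ramCls₀`» (no spherical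
  constituent, ★ «RC» R-12) IS «no `K_v`-fixed vector» and the `= 0` branch holds, while the main branch is Flath–Cartier as in ED. 1 [same cites]; + `traceFactorisation_iff`;
  `TraceFactorisation.mono`-type re-guarding `exists_of_subset`.
* §2 GLUE **`traceFactorisation_kitOfRecord (hPH) (hTF) : ∃ S₀, ∀ S, S₀ ⊆ S → ∀ x fS fT, (𝔠₀.Adm S x → 𝔠₀.trGp x (𝔠₀.tens S fS fT) = 𝔠₀.chS S (𝔠₀.coordS S x) fS * 𝔠₀.hat S (germ … (𝔠₀.evp x)) fT)
  ∧ (¬ 𝔠₀.Adm S x → … = 0)`** at `𝔠₀ = kitOfRecord … (archTr₀ L ι H T hT νinf) ν μv ramCls₀` — the body of the v8 `FactorisationCls 𝔠₀ S₀` under its `∃ S₀` (★ K0 read-backs, `rfl`).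
JUNK AUDIT: as ED. 1 §2 for the tokens (`trGp₀`, `clInfChoiceU`, `clFinChoice`, `evpChoice`, `archTr₀`, `ramCls₀`, `μv v (K_v) = 1` inside PH); the `∃ S₀` is NOT vacuous-making: the
conclusion is still asserted for EVERY finite `S ⊇ S₀` and every class ∕ test datum, and the consumer (core of `shape_of_T5`) works at `S := S₁ ∪ ram ξ ∪ ramCls (cl P) ∪ S₀`.
BOOKS: TF k = 1 (row #3 class part, guarded text); PH 0 expected (★ ED. 1 docstring).  HONEST LABEL: HC_CM is proved only modulo the printed citations until rung 0 closes.
References: [Rogawski1990] §1.5 p. 9, §13.7 p. 206, §14.5 pp. 232–237, §14.6 pp. 236–244; [FlathCorvallis1979] Thms. 3–4; [CartierCorvallis1979] §IV.1; [BorelJacquet1979] §4.1;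
[Knapp1986] Thm. 10.2.
-/

set_option autoImplicit false
-- the mandated namespace has the single-problem summit's repeated segment (`HodgeConjecture.HodgeConjecture`)
set_option linter.dupNamespace false

noncomputable section
namespace Summit.HodgeConjecture.HodgeConjecture.Cruxes.H413.F0P3LettersTraceFactorisationS0

open NumberField IsDedekindDomain MeasureTheory
open Literature.NumberTheory.Rogawski1990 Literature.NumberTheory.GaloisRepresentations
open Literature.NumberTheory.Automorphic Literature.NumberTheory.Automorphic.UnitaryGroup
open Literature.NumberTheory.Automorphic.UnitaryGroup.CotangentForms
open scoped Matrix
open Summit.HodgeConjecture.HodgeConjecture.Cruxes.H413.F0P3InnerFormClassificationV6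
open Summit.HodgeConjecture.HodgeConjecture.Cruxes.H413.F0P3ClassTokensOfRecord (Cls cl rep mult)
open Summit.HodgeConjecture.HodgeConjecture.Cruxes.H413.F0P3ClassTokenChoice (clFinChoice evpChoice)
open Summit.HodgeConjecture.HodgeConjecture.Cruxes.H413.F0P3CompactTrivOfRecord (cptTriv₀)
open Summit.HodgeConjecture.HodgeConjecture.Cruxes.H413.F0P3UnitaryLocOfRecord (clInfChoiceU)
open Summit.HodgeConjecture.HodgeConjecture.Cruxes.H413.F0P3TestFunctionsOfRecord (Unr₀ hat₀)
open Summit.HodgeConjecture.HodgeConjecture.Cruxes.H413.F0P3SpectralSideOfRecord (trGp₀)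
open Summit.HodgeConjecture.HodgeConjecture.Cruxes.H413.F0P3SemilocalTestFunctionsOfRecord (TestS₀ tens₀ chS₀)
open Summit.HodgeConjecture.HodgeConjecture.Cruxes.H413.F0P3bArchDegOneClass (archDegOneClass)
open Summit.HodgeConjecture.HodgeConjecture.Cruxes.H413.F0P3RamClsOfRecord (ramCls₀)
open Summit.HodgeConjecture.HodgeConjecture.Cruxes.H413.F0P3KitOfRecord (kitOfRecord GHSide XiSide)
open Summit.HodgeConjecture.HodgeConjecture.Cruxes.H413.F0P3LettersTraceFactorisation (IsProductHaar)

variable (L : Type) [Field L] [NumberField L] [IsCMField L] (H : Matrix (Fin 3) (Fin 3) L) (ι : L →+* ℂ) (T : GL (Fin 3) ℂ)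
  (hT : (T : Matrix (Fin 3) (Fin 3) ℂ)ᴴ * H.map ι * (T : Matrix (Fin 3) (Fin 3) ℂ) = Literature.Geometry.ComplexHyperbolic.BallModel.J)
  (μ : Measure (Gp L H).automorphicQuotient) [(Gp L H).IsAutomorphicMeasure μ]
  [MeasurableSpace (Gp L H).Adelic] [BorelSpace (Gp L H).Adelic]

/-! ## §1 TF ED. 2 — the letter with the level guard -/

/-- **TF «TraceFactorisation», ED. 2 (LEVEL-GUARDED; row #3 (L7), class part, at the kit of record).**  Under PH (★ `IsProductHaar`: `dg = dg_∞ ⊗ ⊗′ dg_v`, `vol K_v = 1`) THERE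
IS a finite set of places `S₀` (in print: `S₀ ∋` every place where `K_v = U(H)(𝒪_v)` is not hyperspecial — finitely many, ★ `HyperspecialGelfandPair_holds`) such that for every
finite `S ⊇ S₀`, every class `c` of discrete `π′` of `U(H)`, every `S ∪ ∞`-test datum `fS` (★ `TestS₀`) and every unramified tensor `fT = f^S` (★ `Unr₀`):
if `π′` is unramified off `S` (`ramCls₀ (rep c) ⊆ S`, ★ «RC») and `Kc`-trivial (★ `cptTriv₀`) then
`tr π′(f′_{S,∞} ⊗ f^S) = Θ_{π′_∞}(f′_∞) · ∏_{v∈S} tr π′_v(f′_v) · f^{S∧}(t(π′))` (tokens of record as in ★ ED. 1), and otherwise `tr π′(f′_{S,∞} ⊗ f^S) = 0` (off `S ⊇ S₀` the level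
`K_v` is hyperspecial, `dim π′_v^{K_v} ≤ 1`, so a class with no spherical constituent at some `v ∉ S` has NO `K_v`-fixed vector there and is killed by the `K_v`-bi-invariant factor;
a non-`Kc`-trivial class is killed by the `Kc`-bi-invariant `f′_∞`).  [cite: FlathCorvallis1979, Thm. 3 and Thm. 4] [cite: CartierCorvallis1979, §IV.1]
[cite: Rogawski1990, §1.5 p. 9; §13.7 p. 206; §14.5 p. 237; §14.6 pp. 236 and 244] [cite: BorelJacquet1979, §4.1] [cite: Knapp1986, Thm. 10.2] -/
def TraceFactorisation (ν : Measure (Gp L H).Adelic) [IsFiniteMeasureOnCompacts ν]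
    (νinf : @Measure (UnitaryGroup.arch (↥(maximalRealSubfield L)) L (IsCMField.complexConj L) 3 H) (borel _))
    (μv : ∀ v : Places L, @Measure ((cmDatum L 3 H).Local v) (borel _)) : Prop :=
  IsProductHaar L H ν νinf μv →
    ∃ S₀ : Finset (Places L), ∀ S : Finset (Places L), S₀ ⊆ S →
      ∀ (c : Cls (Gp L H) μ) (fS : TestS₀ L H ι T hT S) (fT : Unr₀ L H S),
        (ramCls₀ (rep (Gp L H) μ c) ⊆ ↑S ∧ cptTriv₀ L ι H T hT μ c →
          trGp₀ (Gp L H) μ ν c (tens₀ S fS fT) =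
            chS₀ (UnitaryGroup.archTr₀ L ι H T hT νinf) μv S
                (clInfChoiceU L H ι T hT μ (archDegOneClass 1 (Or.inl rfl)) (rep (Gp L H) μ c), fun v : ↥S => clFinChoice (rep (Gp L H) μ c) v.1) fS *
              hat₀ L H S (germ L H S fun v => evpChoice (rep (Gp L H) μ c) v (μv v)) fT) ∧
        (¬ (ramCls₀ (rep (Gp L H) μ c) ⊆ ↑S ∧ cptTriv₀ L ι H T hT μ c) → trGp₀ (Gp L H) μ ν c (tens₀ S fS fT) = 0)

/-- Unfolding TF ED. 2 (`Iff.rfl`). [cite: FlathCorvallis1979, Thm. 3] [cite: Rogawski1990, §14.5 p. 237] -/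
theorem traceFactorisation_iff (ν : Measure (Gp L H).Adelic) [IsFiniteMeasureOnCompacts ν]
    (νinf : @Measure (UnitaryGroup.arch (↥(maximalRealSubfield L)) L (IsCMField.complexConj L) 3 H) (borel _))
    (μv : ∀ v : Places L, @Measure ((cmDatum L 3 H).Local v) (borel _)) :
    TraceFactorisation L H ι T hT μ ν νinf μv ↔
      (IsProductHaar L H ν νinf μv →
        ∃ S₀ : Finset (Places L), ∀ S : Finset (Places L), S₀ ⊆ S →
          ∀ (c : Cls (Gp L H) μ) (fS : TestS₀ L H ι T hT S) (fT : Unr₀ L H S),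
            (ramCls₀ (rep (Gp L H) μ c) ⊆ ↑S ∧ cptTriv₀ L ι H T hT μ c →
              trGp₀ (Gp L H) μ ν c (tens₀ S fS fT) =
                chS₀ (UnitaryGroup.archTr₀ L ι H T hT νinf) μv S
                    (clInfChoiceU L H ι T hT μ (archDegOneClass 1 (Or.inl rfl)) (rep (Gp L H) μ c), fun v : ↥S => clFinChoice (rep (Gp L H) μ c) v.1) fS *
                  hat₀ L H S (germ L H S fun v => evpChoice (rep (Gp L H) μ c) v (μv v)) fT) ∧
            (¬ (ramCls₀ (rep (Gp L H) μ c) ⊆ ↑S ∧ cptTriv₀ L ι H T hT μ c) → trGp₀ (Gp L H) μ ν c (tens₀ S fS fT) = 0)) :=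
  Iff.rfl

/-- **The UNGUARDED ED. 1 text implies ED. 2** (with `S₀ := ∅`) — so nothing proved against ★ p823853's `TraceFactorisation` is lost; the converse is the content R-28 denies.
[cite: Rogawski1990, §14.6 p. 236] -/
theorem traceFactorisation_of_ed1 (ν : Measure (Gp L H).Adelic) [IsFiniteMeasureOnCompacts ν]
    (νinf : @Measure (UnitaryGroup.arch (↥(maximalRealSubfield L)) L (IsCMField.complexConj L) 3 H) (borel _))
    (μv : ∀ v : Places L, @Measure ((cmDatum L 3 H).Local v) (borel _))
    (h : F0P3LettersTraceFactorisation.TraceFactorisation L H ι T hT μ ν νinf μv) : TraceFactorisation L H ι T hT μ ν νinf μv :=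
  fun hPH => ⟨∅, fun S _ c fS fT => h hPH S c fS fT⟩

/-! ## §2 GLUE — ED. 2 at the kit of record is the guarded class conjunct `∃ S₀, FactorisationCls 𝔠₀ S₀` of T5 v8, token for token -/

/-- **GLUE `traceFactorisation_kitOfRecord`** (v8 shape): under PH, TF ED. 2 yields `∃ S₀, ∀ S ⊇ S₀, ‹class conjunct of law (L7) `Factorisation` at 𝔠₀ and S›` with
`𝔠₀ = kitOfRecord 𝔰 gh ξd μω c jInf dsInf (archTr₀ L ι H T hT νinf) ν μv ramCls₀` — every kit field is its token of record by `rfl` (★ K0 read-backs), so this is the body of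
v8's `FactorisationCls 𝔠₀ S₀` under its existential, and K9β's `factorisationCls_kitOfRecord` is this term. [cite: FlathCorvallis1979, Thm. 3 and Thm. 4] [cite: Rogawski1990, §14.5 p. 237] -/
theorem traceFactorisation_kitOfRecord (𝔰 : Sockets L H μ) (gh : GHSide L H ι T hT 𝔰.PacketG 𝔰.PacketH) (ξd : XiSide L H 𝔰.PacketG 𝔰.PacketH)
    (μω : HeckeCharacter L) (c : ℚ) (jInf dsInf : ℤ → ℤ → ℤ → Cinf)
    (ν : Measure (Gp L H).Adelic) [IsFiniteMeasureOnCompacts ν]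
    (νinf : @Measure (UnitaryGroup.arch (↥(maximalRealSubfield L)) L (IsCMField.complexConj L) 3 H) (borel _))
    (μv : ∀ v : Places L, @Measure ((cmDatum L 3 H).Local v) (borel _))
    (hPH : IsProductHaar L H ν νinf μv) (hTF : TraceFactorisation L H ι T hT μ ν νinf μv) :
    let 𝔠₀ := kitOfRecord L H ι T hT μ 𝔰 gh ξd μω c jInf dsInf (UnitaryGroup.archTr₀ L ι H T hT νinf) ν μv (ramCls₀ (L := L) (H := H) (μ := μ))
    ∃ S₀ : Finset (Places L), ∀ S : Finset (Places L), S₀ ⊆ S → ∀ (x : 𝔠₀.Cls) (fS : 𝔠₀.TestS S) (fT : 𝔠₀.Unr S),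
      (𝔠₀.Adm S x → 𝔠₀.trGp x (𝔠₀.tens S fS fT) = 𝔠₀.chS S (𝔠₀.coordS S x) fS * 𝔠₀.hat S (germ L H S (𝔠₀.evp x)) fT) ∧
      (¬ 𝔠₀.Adm S x → 𝔠₀.trGp x (𝔠₀.tens S fS fT) = 0) := by
  obtain ⟨S₀, h⟩ := hTF hPH
  exact ⟨S₀, fun S hS x fS fT => h S hS x fS fT⟩

end Summit.HodgeConjecture.HodgeConjecture.Cruxes.H413.F0P3LettersTraceFactorisationS0
end
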